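import Summits.NavierStokesRegularity.NavierStokesRegularity.Theorems.PerpetualPumpThesisEnvelopeReformulation
import Summits.NavierStokesRegularity.NavierStokesRegularity.Theorems.PerpetualPumpThesisEnvelopeUpgrade

/-!
# Line `SketchIdeator2` for `PerpetualPump.Thesis`: the crux IS the no-persistent-front statement

Support file (crux stmt-NavierStokesRegularity-1832, line `SketchIdeator2` = idea `besov-envelope-floor`;
lead's closing statement of cycle 1). Every registered stub of the line except its rigidity core K1 is now a
theorem of the tree: the `H¹⁰` local theory (B, E, U, G), the abstract Leray floor in the Besov envelope
(F_A, F_B, reduction; `stub_thesis_AbstractLerayFloor`) and — against the planners' expectation that it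
was open even for Navier–Stokes — the ENVELOPE UPGRADE K2 (`stub_envelopeUpgrade`, worker K2: Type I in
`L^∞` forces Type I in `Ḃ⁰_{∞,1}` along mild solutions of EVERY averaged equation, by the cap × parabolic
profile geometric mean). With the tightness lemma `stub_noPersistentFront_Tight` this pins the route's
target down exactly:

  `Thesis` (abstract Type-I exclusion over Tao's averaging class; J. Amer. Math. Soc. 29 (2016) §1.1,
  p. 8 footnote, `L^∞`-rate tier)  ⟺  K1 `NoPersistentFront`:
  no `H¹⁰_df`-mild solution of a symmetric averaged equation with cancellation, from Schwartz
  divergence-free data, keeps its envelope amplitude `√(T-t)‖u(t)‖_{Ḃ⁰_{∞,1}}` pinched in `[ε, M']`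
  on all of `[0,T)`.

K1 contains forward Navier–Stokes Type-I exclusion (Euler datum) and is predicted FALSE by the route's
ODE pump `CircuitPump` (a theorem of the tree) pending `PumpTransfer` (stmt-1837); a persistent front is
precisely the finite-energy face of a perpetual pump, whose amplitude the floor bounds below
(`stub_thesis_LerayFloorRate`) and K2 bounds above.
-/

noncomputable section

open MeasureTheory Set Filter Topology
open scoped ENNReal NNReal SchwartzMap

set_option linter.dupNamespace false

namespace Summit.NavierStokesRegularity.NavierStokesRegularity.Theorems.PerpetualPumpThesis

open Literature.Analysis.FluidPDE Literature.Analysis.FluidPDE.Tao2016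
open Literature.Analysis.FunctionSpaces
open Summit.NavierStokesRegularity.NavierStokesRegularity.Theses.PerpetualPump

/-- **`Thesis ↔ NoPersistentFront`**: the route's target is exactly the statement that no `H¹⁰_df`-mild
solution of a symmetric cancelling averaged Navier–Stokes equation from Schwartz divergence-free data has
its envelope amplitude `√(T-t)‖u(t)‖_{Ḃ⁰_{∞,1}}` pinched between two positive constants on all of `[0,T)`
(→ tightness; ← the line's composition with the abstract Leray floor and the envelope upgrade, both
theorems). -/
theorem stub_thesis_iff_noPersistentFront : Summit.NavierStokesRegularity.NavierStokesRegularity.Theses.PerpetualPump.Thesis ↔ (∀ 𝒜 : AveragingDatum, 𝒜.IsSymmetric → 𝒜.HasCancellation → ∀ u₀ : 𝓢(EuclideanSpace ℝ (Fin 3), EuclideanSpace ℝ (Fin 3)), VectorCalculus.IsDivFree ⇑u₀ → ∀ T : ℝ, 0 < T → ∀ u : ℝ → L2C, 𝒜.IsMildSolution (schwartzL2 u₀) (Ico 0 T) u → ∀ ε M' : ℝ, 0 < ε → (∀ t ∈ Ico 0 T, ENNReal.ofReal ε ≤ ENNReal.ofReal (Real.sqrt (T - t)) * eHomBesovNorm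 0 ⊤ 1 ((u t : L2C) : 𝓢'(EuclideanSpace ℝ (Fin 3), EuclideanSpace ℂ (Fin 3))) ∧ ENNReal.ofReal (Real.sqrt (T - t)) * eHomBesovNorm 0 ⊤ 1 ((u t : L2C) : 𝓢'(EuclideanSpace ℝ (Fin 3), EuclideanSpace ℂ (Fin 3))) ≤ ENNReal.ofReal M') → False) :=
  ⟨fun h => stub_noPersistentFront_Tight h,
    fun hN => stub_thesis_iff_envelope.mpr ⟨fun 𝒜 hs hc => stub_envelopeUpgrade 𝒜 hs hc, hN⟩⟩

end Summit.NavierStokesRegularity.NavierStokesRegularity.Theorems.PerpetualPumpThesis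

end
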